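import Summits.BirchSwinnertonDyer.BirchSwinnertonDyer.Theorems.ByReductionTypeAtTwoSupersingularOrderTwoNakayama
import Summits.BirchSwinnertonDyer.Rank1Residual.X1.LambdaSqueezeAlgebra
import Literature.NumberTheory.EllipticCurves.IwasawaAlgebraInvolutionEvenLambdaProofs
import Literature.NumberTheory.EllipticCurves.IwasawaAlgebraRankOneIdealProofs
import HarnessLib

/-!
# Route `AlignedTransportAtTwo`, crux C2 `MainConjectureOfRankZeroBSDAtTwo` (stmt-BirchSwinnertonDyer-22298):
# THE TWIN-VALUE LEMMA in `Λ = ℤ₂⟦T⟧` — an `ι`-stable series whose values at the two `ι`-fixed points `T = 0`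
# and `T = −2` of the open disc have DIFFERENT `2`-adic orders has `μ + 2 ≤` both orders; in particular
# `ord₂ F(0) = 2 < ord₂ F(−2)` (or `ord₂ F(−2) = 2 < ord₂ F(0)`) forces `μ(F) = 0`

HONEST FRAMING (cell `bsd-f1-sign2`, WIDTH-5 attached prover seat `bsd-line-att-p5` gen 49 on line `birth` of the lead
`bsd-line-att-p2`; `--supports` stmt-BirchSwinnertonDyer-22298, closes nothing; BSD is NOT proved by any of this; the crux
C2, its verdict «blocked-on `Rank1Residual.GreenbergMuConjectureIrreducible`» and every registered stub are untouched).
THEOREMS ONLY — no `def`, no instance, no named fact, no `sorry`. Pure commutative algebra of `Λ = ℤ₂⟦T⟧`; nothing about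
any curve is asserted here (the arithmetic reading is the sibling file `…TwinValue.lean`).

THE POINT. At `p = 2` the Iwasawa involution `ι : T ↦ (1+T)⁻¹ − 1` has exactly TWO fixed points on the open unit disc
of `ℤ₂`, `T = 0` (the trivial character) and `T = −2` (the character of `ℚ(√2) = ℚ_1`, conductor `8`); the two height-one
primes `(T)`, `(T+2)` are the `ι`-fixed primes of `λ = 1` (tree `IwasawaAlgebraInvolutionEvenLambdaProofs`). For a
non-zero `F ∈ Λ` whose ideal is `ι`-stable (`ιF = u·F`, Greenberg's Thm. 1.14 shape) and which vanishes at neither point,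
write `a = ord₂ F(0)`, `b = ord₂ F(−2)` (the value at `−2` is the tree's `BlindLever.evalAt (−2)`). Factor `F` into primes
of the UFD `Λ`: the prime `2` contributes `(1,1)` to `(a,b)`; an `ι`-MOVED prime `π` comes with its partner `ιπ ≠ π`, and
`(ιπ)(0) = π(0)`, `(ιπ)(−2) = π(−2)`, so the pair contributes `(≥ 2, ≥ 2)`; an `ι`-FIXED prime `π ∌ T, T+2` off `(2)` has
EVEN `λ(π)` by the tree's parity theorem (`even_lambdaInvariant_quotient_of_comap_invol_eq_of_X_add_C_two_notMem`), hence
`λ(π) ≥ 2`, hence `2 ∣ π₁`, hence `π(−2) ≡ π(0) (mod 4)`: it contributes `(1,1)` or `(≥ 2, ≥ 2)`. Consequently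
(`twinValue_dichotomy`) **either `a = b`, or `μ(F) + 2 ≤ a` and `μ(F) + 2 ≤ b`**; so (`mu_add_two_le_of_ne`)
`a ≠ b ⟹ μ(F) + 2 ≤ min(a,b)`, and (`mu_eq_zero_of_two_eq_of_ne`) **`min(a,b) = 2 ∧ a ≠ b ⟹ μ(F) = 0`** — with NO
hypothesis on `λ`, no root, no Newton polygon, no `L`-function.

* §1 evaluation bookkeeping at the blind point `−2`: `evalAt_neg_two_invol` (`(ιF)(−2) = F(−2)`),
  `four_dvd_evalAt_sub_constantCoeff` (`2 ∣ F₁ ⟹ F(−2) ≡ F(0) (mod 4)`), `dvd_coeff_of_lt_lam` (`μ(F) = 0 ⟹ 2 ∣ F_k` for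
  `k < λ(F)`), `mu_le_valuation_constantCoeff` / `mu_le_valuation_evalAt` (`μ(F) ≤ a, b`).
* §2 `ι`-stability passes to cofactors (`iotaStable_of_mul_left`), to the partner prime (`prime_invol`).
* §3 the dichotomy and its corollaries.

References: L. Washington, GTM 83, §7.1, §13.2 [Washington1997]; B. Mazur, J. Tate, J. Teitelbaum, Invent. Math. 84 (1986)
Ch. I §17 (the involution) [MazurTateTeitelbaum1986Invent]; R. Greenberg, LNM 1716 (1999) Thm. 1.14, §4 p. 107, §5 p. 132
[GreenbergLNM1716].
-/

set_option linter.dupNamespace false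
set_option autoImplicit false

noncomputable section

open scoped Classical

namespace Summit.BirchSwinnertonDyer.BirchSwinnertonDyer.Theorems.AlignedTransportAtTwoTwinValueAlgebra

open PowerSeries Literature.NumberTheory.EllipticCurves Literature.NumberTheory.EllipticCurves.IwasawaAlgebra
  Summit.BirchSwinnertonDyer.Rank1Residual.X1.MuLambda Summit.BirchSwinnertonDyer.Rank1Residual.X1.ParitySqueeze
  Summit.BirchSwinnertonDyer.Rank1Residual.Supersingular Summit.BirchSwinnertonDyer.Rank1Residual.Supersingular.BlindLever
  Summit.BirchSwinnertonDyer.BirchSwinnertonDyer.Theorems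

/-! ## §1 Evaluation at the blind point `T = −2` and `2`-adic bookkeeping -/

section Eval

/-- `(2 : ℤ₂) ≠ 0`. [folklore] -/
theorem two_ne_zero_padicInt : (2 : ℤ_[2]) ≠ 0 := by exact_mod_cast (two_ne_zero : (2 : ℤ) ≠ 0)

/-- `ord₂ 2 = 1` in `ℤ₂`. [folklore] -/
theorem valuation_two : (2 : ℤ_[2]).valuation = 1 := by
  have h := PadicInt.valuation_p (p := 2)
  rwa [Nat.cast_ofNat] at h

/-- `ord₂ (2^n · c) = n + ord₂ c` for `c ≠ 0`. [folklore] -/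
theorem valuation_two_pow_mul (n : ℕ) {c : ℤ_[2]} (hc : c ≠ 0) : ((2 : ℤ_[2]) ^ n * c).valuation = n + c.valuation := by
  have h := PadicInt.valuation_p_pow_mul (p := 2) n c hc
  rwa [Nat.cast_ofNat] at h

/-- `ord₂ (2 · c) = 1 + ord₂ c` for `c ≠ 0`. [folklore] -/
theorem valuation_two_mul {c : ℤ_[2]} (hc : c ≠ 0) : ((2 : ℤ_[2]) * c).valuation = 1 + c.valuation := by
  have h := valuation_two_pow_mul 1 hc
  rwa [pow_one] at h

/-- `2^n ∣ x ≠ 0` iff `n ≤ ord₂ x`. [folklore] -/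
theorem two_pow_dvd_iff_le_valuation {x : ℤ_[2]} (hx : x ≠ 0) (n : ℕ) : (2 : ℤ_[2]) ^ n ∣ x ↔ n ≤ x.valuation := by
  rw [← Ideal.mem_span_singleton]
  have h := PadicInt.mem_span_pow_iff_le_valuation x hx n
  rwa [Nat.cast_ofNat] at h

/-- A non-unit of `ℤ₂` has positive `2`-adic order. [folklore] -/
theorem one_le_valuation_of_not_isUnit {x : ℤ_[2]} (hx : x ≠ 0) (hu : ¬ IsUnit x) : 1 ≤ x.valuation := by
  rw [← two_pow_dvd_iff_le_valuation hx 1, pow_one]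
  have hlt : ‖x‖ < 1 := lt_of_le_of_ne (PadicInt.norm_le_one x) (fun h ↦ hu (PadicInt.isUnit_iff.mpr h))
  have h := (PadicInt.norm_lt_one_iff_dvd x).mp hlt
  rwa [Nat.cast_ofNat] at h

/-- If `4 ∣ x − y` with `x, y ≠ 0` then `2 ≤ ord₂ x ↔ 2 ≤ ord₂ y`. [folklore] -/
theorem two_le_valuation_iff_of_four_dvd_sub {x y : ℤ_[2]} (hx : x ≠ 0) (hy : y ≠ 0) (h : (4 : ℤ_[2]) ∣ x - y) :
    2 ≤ x.valuation ↔ 2 ≤ y.valuation := by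
  have h4 : (4 : ℤ_[2]) = 2 ^ 2 := by norm_num
  rw [h4] at h
  rw [← two_pow_dvd_iff_le_valuation hx 2, ← two_pow_dvd_iff_le_valuation hy 2]
  constructor
  · intro hx2
    have := dvd_sub hx2 h
    rwa [sub_sub_cancel] at this
  · intro hy2
    have := dvd_add h hy2
    rwa [sub_add_cancel] at this

/-- The value at `−2` of the involution variable `(1+T)⁻¹ − 1` is `−2` (the point `−2` is `ι`-FIXED: `(1−2)⁻¹ − 1 = −2`).
[cite: MazurTateTeitelbaum1986Invent, Ch. I §17] -/
theorem evalAt_neg_two_invSubOne : evalAt (-2 : ℤ_[2]) (invSubOne 2) = -2 := by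
  have h := congrArg (evalAtHom norm_neg_two_lt_one) (one_add_X_mul_one_add_invSubOne 2)
  simp only [map_mul, map_add, map_one, evalAtHom_apply, evalAt_X] at h
  -- `h : (1 + (-2)) * (1 + e) = 1`
  linear_combination (-1 : ℤ_[2]) * h

/-- **`(ιF)(−2) = F(−2)`**: evaluation at the `ι`-fixed point `−2` is `ι`-invariant. Proof: both `F ↦ F(−2)` and
`F ↦ (ιF)(−2)` are ring maps `Λ → ℤ₂` fixing constants; they agree on `T` (`ιT ↦ −2`), hence on polynomials, and a series is
its Weierstrass remainder modulo `T + 2` plus a multiple of `T + 2`, both of which they treat alike.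
[cite: MazurTateTeitelbaum1986Invent, Ch. I §17] [cite: Washington1997, §7.1] -/
theorem evalAt_neg_two_invol (F : IwasawaAlgebra 2) : evalAt (-2 : ℤ_[2]) (invol 2 F) = evalAt (-2 : ℤ_[2]) F := by
  obtain ⟨q, hq⟩ := exists_eq_X_sub_C_mul_add_C_evalAt norm_neg_two_lt_one F
  have hιX : evalAt (-2 : ℤ_[2]) (invol 2 (PowerSeries.X - PowerSeries.C (-2 : ℤ_[2]))) = 0 := by
    rw [map_sub, invol_X, invol_C, evalAt_sub norm_neg_two_lt_one, evalAt_neg_two_invSubOne, evalAt_C, sub_self]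
  conv_lhs => rw [hq]
  rw [map_add, map_mul, invol_C, evalAt_add norm_neg_two_lt_one, evalAt_mul norm_neg_two_lt_one, hιX, zero_mul,
    zero_add, evalAt_C]

/-- **`F(−2) ≡ F(0) − 2F₁ (mod 4)`**, precisely `F(−2) = F₀ − 2F₁ + 4·G(−2)` for the twice-shifted series `G`.
[cite: Washington1997, §7.1] -/
theorem evalAt_neg_two_eq (F : IwasawaAlgebra 2) : ∃ c : ℤ_[2],
    evalAt (-2 : ℤ_[2]) F = constantCoeff F - 2 * coeff 1 F + 4 * c := by
  set F₁ : PowerSeries ℤ_[2] := PowerSeries.mk fun n ↦ coeff (n + 1) F with hF₁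
  set F₂ : PowerSeries ℤ_[2] := PowerSeries.mk fun n ↦ coeff (n + 1) F₁ with hF₂
  have h1 : F = PowerSeries.X * F₁ + PowerSeries.C (constantCoeff F) := eq_X_mul_shift_add_const F
  have h2 : F₁ = PowerSeries.X * F₂ + PowerSeries.C (constantCoeff F₁) := eq_X_mul_shift_add_const F₁
  have hc : constantCoeff F₁ = coeff 1 F := by
    rw [hF₁, ← coeff_zero_eq_constantCoeff_apply, coeff_mk]
  refine ⟨evalAt (-2 : ℤ_[2]) F₂, ?_⟩
  have e1 := congrArg (evalAtHom norm_neg_two_lt_one) h1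
  have e2 := congrArg (evalAtHom norm_neg_two_lt_one) h2
  simp only [map_add, map_mul, evalAtHom_apply, evalAt_X, evalAt_C] at e1 e2
  rw [e1, e2, hc]
  ring

/-- **`2 ∣ F₁ ⟹ 4 ∣ F(−2) − F(0)`**. [cite: Washington1997, §7.1] -/
theorem four_dvd_evalAt_sub_constantCoeff {F : IwasawaAlgebra 2} (h1 : (2 : ℤ_[2]) ∣ coeff 1 F) :
    (4 : ℤ_[2]) ∣ evalAt (-2 : ℤ_[2]) F - constantCoeff F := by
  obtain ⟨c, hc⟩ := evalAt_neg_two_eq F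
  obtain ⟨d, hd⟩ := h1
  refine ⟨c - d, ?_⟩
  rw [hc, hd]
  ring

/-- **`μ(F) = 0 ⟹ p ∣ F_k` for `k < λ(F)`**: a series not divisible by `p` is `≡ unit · T^{λ}` modulo `p`
(`λ` = the order of vanishing of `F mod p`). [cite: Washington1997, §7.1 (Thm. 7.3)] -/
theorem dvd_coeff_of_lt_lam {p : ℕ} [Fact p.Prime] {F : IwasawaAlgebra p} (hF : F ≠ 0) (hμ : mu F = 0) {k : ℕ}
    (hk : k < lam F) : (p : ℤ_[p]) ∣ coeff k F := by
  have hpf : pfree F = F := by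
    have h := eq_C_pow_mu_mul_pfree F
    rw [hμ, pow_zero, map_one, one_mul] at h
    exact h.symm
  have hred : red F ≠ 0 := by rw [← hpf]; exact red_pfree_ne_zero hF
  have hord : (k : ℕ∞) < (red F).order := by
    rw [lam, hpf] at hk
    have hfin : (red F).order ≠ ⊤ := (order_finite_iff_ne_zero.mpr hred).ne
    rw [← ENat.coe_toNat hfin]
    exact_mod_cast hk
  have hc : coeff k (red F) = 0 := coeff_of_lt_order k hord
  rw [coeff_map] at hc
  have hmem : coeff k F ∈ IsLocalRing.maximalIdeal ℤ_[p] := (IsLocalRing.residue_eq_zero_iff _).mp hc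
  rw [PadicInt.maximalIdeal_eq_span_p, Ideal.mem_span_singleton] at hmem
  exact hmem

/-- `μ(F) ≤ ord₂ F(0)` when `F(0) ≠ 0` (`2^{μ} ∣ F`). [cite: Washington1997, §7.1] -/
theorem mu_le_valuation_constantCoeff {F : IwasawaAlgebra 2} (hF : F ≠ 0) (h0 : constantCoeff F ≠ 0) :
    mu F ≤ (constantCoeff F).valuation := by
  obtain ⟨G, hG⟩ := C_pow_mu_dvd hF
  have hcc : constantCoeff F = (2 : ℤ_[2]) ^ mu F * constantCoeff G := by
    conv_lhs => rw [hG]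
    rw [map_mul, constantCoeff_C, Nat.cast_ofNat]
  have hG0 : constantCoeff G ≠ 0 := fun h ↦ h0 (by rw [hcc, h, mul_zero])
  rw [hcc, valuation_two_pow_mul _ hG0]
  exact Nat.le_add_right _ _

/-- `μ(F) ≤ ord₂ F(−2)` when `F(−2) ≠ 0` (`2^{μ} ∣ F` and evaluation is a ring map). [cite: Washington1997, §7.1] -/
theorem mu_le_valuation_evalAt {F : IwasawaAlgebra 2} (hF : F ≠ 0) (h2 : evalAt (-2 : ℤ_[2]) F ≠ 0) :
    mu F ≤ (evalAt (-2 : ℤ_[2]) F).valuation := by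
  obtain ⟨G, hG⟩ := C_pow_mu_dvd hF
  have hev : evalAt (-2 : ℤ_[2]) F = (2 : ℤ_[2]) ^ mu F * evalAt (-2 : ℤ_[2]) G := by
    conv_lhs => rw [hG]
    rw [evalAt_mul norm_neg_two_lt_one, evalAt_C, Nat.cast_ofNat]
  have hG0 : evalAt (-2 : ℤ_[2]) G ≠ 0 := fun h ↦ h2 (by rw [hev, h, mul_zero])
  rw [hev, valuation_two_pow_mul _ hG0]
  exact Nat.le_add_right _ _

/-- A non-unit `F ∈ Λ` has `ord₂ F(0) ≥ 1` (when `F(0) ≠ 0`). [cite: Washington1997, §7.1] -/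
theorem one_le_valuation_constantCoeff_of_not_isUnit {F : IwasawaAlgebra 2} (hu : ¬ IsUnit F) (h0 : constantCoeff F ≠ 0) :
    1 ≤ (constantCoeff F).valuation :=
  one_le_valuation_of_not_isUnit h0 (fun h ↦ hu (isUnit_iff_constantCoeff.mpr h))

/-- A non-unit `F ∈ Λ` has `ord₂ F(−2) ≥ 1` (when `F(−2) ≠ 0`; `F(−2) ≡ F(0) (mod 2)`). [cite: Washington1997, §7.1] -/
theorem one_le_valuation_evalAt_of_not_isUnit {F : IwasawaAlgebra 2} (hu : ¬ IsUnit F) (h2 : evalAt (-2 : ℤ_[2]) F ≠ 0) :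
    1 ≤ (evalAt (-2 : ℤ_[2]) F).valuation :=
  one_le_valuation_of_not_isUnit h2 (fun h ↦ hu ((isUnit_evalAt_iff norm_neg_two_lt_one F).mp h))

/-- `2` is a prime element of `Λ = ℤ₂⟦T⟧` (tree `IwasawaAlgebra.prime_C`, numeral spelling). [cite: Washington1997, §13.1] -/
theorem prime_C_two : Prime (PowerSeries.C (2 : ℤ_[2]) : IwasawaAlgebra 2) := by
  have h := IwasawaAlgebra.prime_C 2
  rwa [Nat.cast_ofNat] at h

/-- `μ(2) = 1` in `ℤ₂⟦T⟧`. [cite: Washington1997, §7.1] -/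
theorem mu_C_two : mu (PowerSeries.C (2 : ℤ_[2]) : IwasawaAlgebra 2) = 1 := by
  have hred : red (1 : IwasawaAlgebra 2) ≠ 0 := by
    rw [Ne, red_eq_zero_iff, Nat.cast_ofNat]
    intro h
    exact prime_C_two.not_unit (isUnit_of_dvd_one h)
  have h : (PowerSeries.C (2 : ℤ_[2]) : IwasawaAlgebra 2) = PowerSeries.C (((2 : ℕ) : ℤ_[2]) ^ 1) * 1 := by
    rw [pow_one, mul_one, Nat.cast_ofNat]
  exact (mu_eq_and_pfree_eq hred h).1

/-- `μ(π) = 0` for an irreducible `π` of `Λ` not associated with `2`. [cite: Washington1997, §7.1] -/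
theorem mu_eq_zero_of_irreducible_of_not_associated {π : IwasawaAlgebra 2} (hπ : Irreducible π)
    (h2 : ¬ Associated π (PowerSeries.C (2 : ℤ_[2]))) : mu π = 0 := by
  by_contra hne
  have h1 : 1 ≤ mu π := Nat.one_le_iff_ne_zero.mpr hne
  have hdvd : (PowerSeries.C (2 : ℤ_[2]) : IwasawaAlgebra 2) ∣ π := by
    have h := C_pow_mu_dvd hπ.ne_zero
    rw [Nat.cast_ofNat] at h
    exact (dvd_trans (by rw [map_pow]; exact dvd_pow_self _ (by omega)) h)
  exact h2 (prime_C_two.irreducible.associated_of_dvd hπ hdvd).symm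

end Eval

/-! ## §2 `ι`-stability: cofactors and partner primes -/

section Iota

/-- **`ι`-stability passes to a cofactor**: if `ιF = u·F`, `F = A·B` with `A ≠ 0` and `ιA = w·A`, then `ιB = (w⁻¹u)·B`.
[cite: GreenbergLNM1716, Thm. 1.14] -/
theorem iotaStable_of_mul_left {F A B : IwasawaAlgebra 2} (hF : ∃ u : (IwasawaAlgebra 2)ˣ, invol 2 F = u * F)
    (hAB : F = A * B) (hA0 : A ≠ 0) (hA : ∃ w : (IwasawaAlgebra 2)ˣ, invol 2 A = w * A) :
    ∃ u : (IwasawaAlgebra 2)ˣ, invol 2 B = u * B := by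
  obtain ⟨u, hu⟩ := hF
  obtain ⟨w, hw⟩ := hA
  refine ⟨w⁻¹ * u, ?_⟩
  have h : A * (w * invol 2 B) = A * (u * B) := by
    have e : invol 2 F = invol 2 A * invol 2 B := by rw [hAB, map_mul]
    rw [hu, hw, hAB] at e
    linear_combination -e
  have h' : (w : IwasawaAlgebra 2) * invol 2 B = u * B := mul_left_cancel₀ hA0 h
  rw [Units.val_mul, mul_assoc, ← h', ← mul_assoc, Units.inv_mul, one_mul]

/-- The partner `ιπ` of a prime `π` is prime (`ι` is a ring automorphism). [cite: MazurTateTeitelbaum1986Invent, Ch. I §17] -/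
theorem prime_invol {π : IwasawaAlgebra 2} (hπ : Prime π) : Prime (invol 2 π) :=
  (MulEquiv.prime_iff (involEquiv 2).toMulEquiv).mpr hπ

/-- `ιπ ∣ F` whenever `π ∣ F` and `(F)` is `ι`-stable. [cite: GreenbergLNM1716, Thm. 1.14] -/
theorem invol_dvd_of_dvd {F π : IwasawaAlgebra 2} (hF : ∃ u : (IwasawaAlgebra 2)ˣ, invol 2 F = u * F) (h : π ∣ F) :
    invol 2 π ∣ F := by
  obtain ⟨u, hu⟩ := hF
  have h1 : invol 2 π ∣ invol 2 F := map_dvd (invol 2) h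
  rw [hu] at h1
  exact (Units.dvd_mul_left).mp h1

/-- The product `π · ιπ` is `ι`-INVARIANT (as an element). [cite: MazurTateTeitelbaum1986Invent, Ch. I §17] -/
theorem invol_mul_invol_self (π : IwasawaAlgebra 2) : invol 2 (π * invol 2 π) = π * invol 2 π := by
  rw [map_mul, invol_invol, mul_comm]

/-- An `ι`-fixed prime ideal `(π)` (i.e. `ιπ ~ π`) is a fixed point of `ι` on `Spec Λ`. [cite: GreenbergLNM1716, Thm. 1.14] -/
theorem comap_invol_eq_of_associated {π : IwasawaAlgebra 2} (hπ : Prime π) (hfix : Associated (invol 2 π) π) :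
    PrimeSpectrum.comap (invol 2).toRingHom ⟨Ideal.span {π}, (Ideal.span_singleton_prime hπ.ne_zero).mpr hπ⟩ =
      ⟨Ideal.span {π}, (Ideal.span_singleton_prime hπ.ne_zero).mpr hπ⟩ := by
  have hspan : Ideal.span {invol 2 π} = Ideal.span {π} := Ideal.span_singleton_eq_span_singleton.mpr hfix
  apply PrimeSpectrum.ext
  rw [PrimeSpectrum.comap_asIdeal]
  ext f
  rw [Ideal.mem_comap]
  change invol 2 f ∈ Ideal.span {π} ↔ f ∈ Ideal.span {π}
  constructor
  · intro hf
    rw [← hspan] at hf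
    obtain ⟨h, hh⟩ := Ideal.mem_span_singleton.mp hf
    exact Ideal.mem_span_singleton.mpr ⟨invol 2 h, by rw [← invol_invol 2 f, hh, map_mul, invol_invol]⟩
  · intro hf
    obtain ⟨h, hh⟩ := Ideal.mem_span_singleton.mp hf
    rw [← hspan]
    exact Ideal.mem_span_singleton.mpr ⟨invol 2 h, by rw [hh, map_mul]⟩

/-- `Λ/(π)` is a torsion `Λ`-module for `π ≠ 0`. [cite: Washington1997, §13.2] -/
theorem isTorsion_quotient_span_singleton' {π : IwasawaAlgebra 2} (hπ0 : π ≠ 0) :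
    Module.IsTorsion (IwasawaAlgebra 2) (IwasawaAlgebra 2 ⧸ Ideal.span {π}) := by
  intro x
  obtain ⟨y, rfl⟩ := Ideal.Quotient.mk_surjective x
  refine ⟨⟨π, mem_nonZeroDivisors_of_ne_zero hπ0⟩, ?_⟩
  change Ideal.Quotient.mk (Ideal.span {π}) (π * y) = 0
  exact Ideal.Quotient.eq_zero_iff_mem.mpr (Ideal.mem_span_singleton.mpr ⟨y, rfl⟩)

/-- **PARITY at an `ι`-fixed prime (`p = 2`)**: a prime `π` of `Λ = ℤ₂⟦T⟧` with `ιπ ~ π` dividing neither `T` nor `T + 2`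
(i.e. `T ∉ (π)`, `T + 2 ∉ (π)`) has EVEN `λ(π)` (tree parity theorem for `λ(Λ/(π))`, and `λ(Λ/(π)) = λ(π)`). [cite: MazurTateTeitelbaum1986Invent, Ch. I §17] [cite: GreenbergLNM1716, Thm. 1.14] -/
theorem even_lam_of_fixed_prime {π : IwasawaAlgebra 2} (hπ : Prime π) (hfix : Associated (invol 2 π) π)
    (hX : ¬ π ∣ PowerSeries.X) (hX2 : ¬ π ∣ (PowerSeries.X + PowerSeries.C (2 : ℤ_[2]))) : Even (lam π) := by
  let 𝔭 : PrimeSpectrum (IwasawaAlgebra 2) := ⟨Ideal.span {π}, (Ideal.span_singleton_prime hπ.ne_zero).mpr hπ⟩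
  have hfix' := comap_invol_eq_of_associated hπ hfix
  have hX' : (PowerSeries.X : IwasawaAlgebra 2) ∉ 𝔭.asIdeal := fun h ↦ hX (Ideal.mem_span_singleton.mp h)
  have hX2' : (PowerSeries.X + PowerSeries.C (2 : ℤ_[2]) : IwasawaAlgebra 2) ∉ 𝔭.asIdeal :=
    fun h ↦ hX2 (Ideal.mem_span_singleton.mp h)
  have heven := IwasawaAlgebra.even_lambdaInvariant_quotient_of_comap_invol_eq_of_X_add_C_two_notMem 𝔭 hfix' hX' hX2'
  have hbridge : lam π = lambdaInvariant 2 (IwasawaAlgebra 2 ⧸ Ideal.span {π}) :=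
    lam_generator_eq_lambdaInvariant (IwasawaAlgebra 2 ⧸ Ideal.span {π}) (isTorsion_quotient_span_singleton' hπ.ne_zero)
      hπ.ne_zero (Literature.NumberTheory.EllipticCurves.Module.charIdeal_quotient_span_singleton hπ.ne_zero)
  rw [hbridge]
  exact heven

/-- **The local alternative at an `ι`-fixed prime**: for a prime `π` of `Λ` off `(2)`, `ι`-fixed, dividing neither `T` nor
`T + 2`: `π(−2) ≡ π(0) (mod 4)` — so `ord₂ π(0) ≥ 2 ↔ ord₂ π(−2) ≥ 2` (both orders are `≥ 1`).
[cite: MazurTateTeitelbaum1986Invent, Ch. I §17] [cite: Washington1997, §7.1] -/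
theorem four_dvd_of_fixed_prime {π : IwasawaAlgebra 2} (hπ : Prime π) (hμ : mu π = 0) (hfix : Associated (invol 2 π) π)
    (hX : ¬ π ∣ PowerSeries.X) (hX2 : ¬ π ∣ (PowerSeries.X + PowerSeries.C (2 : ℤ_[2]))) :
    (4 : ℤ_[2]) ∣ evalAt (-2 : ℤ_[2]) π - constantCoeff π := by
  have heven := even_lam_of_fixed_prime hπ hfix hX hX2
  have hlam0 : lam π ≠ 0 := by
    intro h0
    exact hπ.not_unit ((isUnit_iff_mu_eq_zero_and_lam_eq_zero π).mpr ⟨hπ.ne_zero, hμ, h0⟩)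
  have h2 : 2 ≤ lam π := by obtain ⟨k, hk⟩ := heven; omega
  have h1 : ((2 : ℕ) : ℤ_[2]) ∣ coeff 1 π := dvd_coeff_of_lt_lam hπ.ne_zero hμ (by omega)
  rw [Nat.cast_ofNat] at h1
  exact four_dvd_evalAt_sub_constantCoeff h1

end Iota

end Summit.BirchSwinnertonDyer.BirchSwinnertonDyer.Theorems.AlignedTransportAtTwoTwinValueAlgebra

end
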